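import Literature.NumberTheory.Automorphic.Liu2021.LemD1Item1AtV2OfSplit
import Literature.NumberTheory.Automorphic.Liu2021.Def411WeilCarriersIrreducibleOrZeroAtLine
import Literature.NumberTheory.GelbartRogawski1991.CMSplittingCharLocalMu
import Literature.RepresentationTheory.Liu2021.OscillatorConventions
import HarnessLib

/-!
# [Liu2021, Lem. D.1, FIRST SENTENCE] («`ω(μ, ε, χ)` is irreducible and admissible») at a NON-SPLIT place, every rank `n ≥ 2`, PROVED on the
# `U(V)(F_v)`-datum `localLemD1DataAtV₂` — and its reading on the rank-2 CM θ-package of the letter ★ `LemD1_1AsPrintedNonsplitCM₂`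

Topic `NumberTheory/Automorphic/Liu2021`; namespace `Literature.NumberTheory.Automorphic.Liu2021.Def411WeilCarriers` (that of ★
`LemD1Item1AtV2OfSplit.lean`, whose split-place road this file re-walks at the non-split places).  KERNEL: theorems only.
Cell hodgecm-mathlib FLOOR 0, programme P5, row «L1ns-cut2» (P) (desk F0P5-plan (g4), cell bus 2026-08-31T19:00:14Z; dealt to B-p08 (g23),
passed to and written by the typer seat B-typ04 (g18); road = ★ B-p04 (g30) `LemD1Item1AtV2OfSplit.lean` with the non-split input).

WHY.  ★ `LemD1_1AsPrinted L` ([Liu2021, Lem. D.1, first sentence + item (1)] AS PRINTED, `LemD1AsPrinted.lean` :261) is the conjunction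
(first sentence: `IsIrreducibleOrZero L.datum.quot ∧ L.datum.quot.IsAdmissible`) ∧ (item (1): the vanishing criterion).  The open letter of the
P5 pay-down line after ED. 5∕6 is `LemD1RankTwoCMLetters.LemD1_1AsPrintedNonsplitCM₂` = `LemD1_1AsPrinted` of the rank-2 CM θ-package datum at
the NON-SPLIT places.  But the FIRST SENTENCE at a non-split place is an in-house theorem for every rank: ★
`isIrreducibleOrZero_and_isAdmissible_local_of_isField` (`Def411WeilCarriersIrreducibleOrZeroAtLine.lean` :101 — [MoeglinVignerasWaldspurger1987,
Chap. 3 IV.4 Thm principal 1a), 2a)] for the pair `(U(⟨a⟩), U(J_V ⊗ (a)))`, the tree's PROVED `mvw_IV4_rankOne_irreducibleOrZero_holds` ∕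
`mvw_IV4_rankOne_admissible_holds`) gives «irreducible-or-zero ∧ admissible» for the `χ_v`-coinvariants `Θ_v` of `ω_v = 𝓢.omegaLoc v` on the
BIG group `U(J_V ⊗ (a))(F_v)` whenever `E ⊗_F F_v = LocalRing E v` IS a field.  This file carries the two adjectives down to the datum, exactly
as ★ B-p04 (g30) `lemD1_1AsPrinted_localLemD1DataAtV₂_of_not_isField` does at the split places:

* §1 `isIrreducibleOrZero_and_isAdmissible_localLemD1DataAtV₂_of_isField` — GENERIC (`F`, `E`, `c`, rank `N`, `n ≥ 2`, frame `J_V`, line `a`,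
  splitting family `𝓢`, Step-2 character `μ` the caller's, `χ`, place `v`, hypothesis `IsField (LocalRing E v)`): the adjectives of `Θ_v`
  descend to `Θ_v ∘ localLineInl v` on `U(J_V)(F_v)` (`localLineInl` is ONTO — ★ `localLineInl_surjective`, so «irreducible or zero» is
  preserved verbatim by ★ `isIrreducibleOrZero_comp_iff_of_surjective`; admissibility along the CONTINUOUS OPEN map — ★ `continuous_localLineInl`,
  ★ `isOpenMap_localLineInl`), then to the datum's `ω(μ_v, ε_v, χ_v)` along ★ `quotEquivLocalType₂` over the topological group isomorphism
  `uEquiv` (irreducible-or-zero by the case split zero ∕ non-zero — on a non-zero quotient Liu's adjective is Mathlib's `IsIrreducible`,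
  ★ `isIrreducible_of_nontrivial`, transported by `Representation.isIrreducible_iff_of_equivariant`; admissibility by
  `Representation.IsAdmissible.of_equivariant_mulEquiv` — B-p04's `h1`∕`h2` blocks token for token).  NO unitarity (`hL2`) hypothesis: the
  non-split input takes none.
* §2 `isIrreducibleOrZero_and_isAdmissible_localLemD1DataAtV₂_cm_of_forall_smul_eq` — the READING on the rank-2 CM θ-package: binders = those
  of ★ `LemD1RankTwoCMLetters.LemD1_1AsPrintedNonsplitCM₂` at ONE place `v` plus its guard
  `(hv : ∀ w : UnitaryGroup.PlacesOver L v, IsCMField.complexConj L • (w : HeightOneSpectrum (𝓞 L)) = w)` (⇒ `IsField (LocalRing L v)` by the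
  contrapositive of ★ `SplitPlace.exists_placesOver_smul_ne_of_not_isField`), conclusion LITERALLY the first conjunct of the letter's body on the
  letter's datum term.  Consumed by the (T) leg: `LemD1RankTwoCMLetters.LemD1_1VanishingNonsplitCM₂.toNonsplit` (ED. 3 of the letters file).

HONEST SCOPE: nothing of [Liu2021] is asserted; §1–§2 are theorems of the tree over PROVED interface facts.  The printed item (1) proper (the
`ε`-dichotomy vanishing criterion, [HarrisKudlaSweet1996, Prop. 5.1 (iii)] + [SZ15, Thm. 1.10] in Liu's proof l. 5245) remains the consumer's
letter.  HC_CM is proved only modulo the printed citations — the 2 remaining named inputs (hLiu418, h413) — until rung 0 closes.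

## References
* [Liu2021] Y. Liu, Camb. J. Math. 9 (2021) = arXiv:2102.11518, App. D Lemma D.1, first sentence (p. 125, l. 5227); proof l. 5243 (p. 126): «The
  fact that `ω(μ, ε, χ)` is irreducible is a special case of the Howe duality; see for example [GT16, Theorem 1.1 (1)].»
* [MoeglinVignerasWaldspurger1987] C. Mœglin, M.-F. Vignéras, J.-L. Waldspurger, *Correspondances de Howe sur un corps p-adique*, LNM 1291
  (1987), Chap. 3, IV.4, Théorème principal 1a), 2a).
* [BernsteinZelevinsky1976] I. N. Bernstein, A. V. Zelevinsky, Russian Math. Surveys 31 (1976), Definition 2.1(b) (admissibility).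
-/

set_option autoImplicit false

noncomputable section

open scoped Matrix Kronecker TensorProduct Classical RestrictedProduct
open NumberField IsDedekindDomain Filter Set
open _root_.MeasureTheory
open Literature.NumberTheory Literature.NumberTheory.Automorphic Literature.NumberTheory.Automorphic.UnitaryGroup
open Literature.NumberTheory.Weil1964 Literature.RepresentationTheory
open Literature.RepresentationTheory.HeisenbergGroup
open Literature.RepresentationTheory.CentralCharacterQuotient (augmentation)

namespace Literature.NumberTheory.Automorphic.Liu2021.Def411WeilCarriers

open Literature.NumberTheory.GelbartRogawski1991 Literature.NumberTheory.GelbartRogawski1991.UnitaryDualPair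
open Literature.NumberTheory.GelbartRogawski1991.UnitaryDualPair.WeilCoinv
open Literature.NumberTheory.GelbartRogawski1991.GRConstruction

/-! ## §1 The first sentence at a NON-SPLIT place on the `U(V)(F_v)`-datum `localLemD1DataAtV₂`, every rank `n ≥ 2` -/

section AtV

variable (F E : Type) [Field F] [NumberField F] [Field E] [NumberField E] [Algebra F E]
variable (c : E ≃ₐ[F] E) (N : ℕ) {n : ℕ} (e : Fin N × Fin 1 ≃ Fin n)
variable (JV : Matrix (Fin N) (Fin N) E) {TV : Matrix (Fin N) (Fin N) F}
variable [Algebra.IsQuadraticExtension F E] {δ : E} (hcδ : c δ = -δ) (hδ : δ ≠ 0) {d : F} (hd : δ * δ = algebraMap F E d)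

/-- **[Liu2021, Lem. D.1, FIRST SENTENCE] at a place `v` NON-SPLIT in `E` (`E ⊗_F F_v` a field), every rank `n ≥ 2`, on the rank-`≥ 2` datum
`localLemD1DataAtV₂ … v`**: «`ω(μ_v, ε_v, χ_v)` is irreducible (or zero) and admissible» — `IsIrreducibleOrZero (…).datum.quot ∧ (…).datum.quot.IsAdmissible`
(the first conjunct of ★ `LemD1_1AsPrinted (localLemD1DataAtV₂ … v)`, binders token for token those of ★ `lemD1_1AsPrinted_localLemD1DataAtV₂_of_not_isField`
minus the split hypothesis, the measure and `hL2`, plus `hf : IsField (LocalRing E v)`).  PROOF: ★ `isIrreducibleOrZero_and_isAdmissible_local_of_isField`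
([MVW, IV.4] PROVED) on `U(J_V ⊗ (a))(F_v)` → `∘ localLineInl v` (onto; continuous, open) → the datum along ★ `quotEquivLocalType₂` over `uEquiv`.
[cite: Liu2021, App. D Lemma D.1, first sentence (p. 125, l. 5227); proof l. 5243 (p. 126)]
[cite: MoeglinVignerasWaldspurger1987, Chap. 3 IV.4 Thm principal 1a), 2a)] [cite: BernsteinZelevinsky1976, Definition 2.1(b)] -/
theorem isIrreducibleOrZero_and_isAdmissible_localLemD1DataAtV₂_of_isField (hV : TV.IsSymm) (hVd : IsUnit TV.det)
    (hJV : JV = TV.map (algebraMap F E)) (a : Fˣ)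
    (𝓢 : LocalSplitting.FinLocalSplittings F E c n hcδ hδ hd (gram F e TV (TW F a)) (isSymm_gram F e hV (isSymm_TW F a))
      (reindex_kronecker_eq_gram_map F E e hJV (JW_eq F E a)))
    (hn : 2 ≤ n) (μ : ∀ v : HeightOneSpectrum (𝓞 F), (LocalRing E v)ˣ →* ℂˣ) (hμn : ∀ v x, ‖((μ v x : ℂˣ) : ℂ)‖ = 1)
    (hμc : ∀ v, Continuous fun x => ((μ v x : ℂˣ) : ℂ))
    (hμF : ∀ (v : HeightOneSpectrum (𝓞 F)) (t : (v.adicCompletion F)ˣ),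
      μ v (Units.map (algebraMap (v.adicCompletion F) (LocalRing E v)).toMonoidHom t) = 1 ↔
        ∃ x : (LocalRing E v)ˣ, (x : LocalRing E v) * conjLocal E c v x = algebraMap (v.adicCompletion F) (LocalRing E v) t)
    (χ : Chi F E c) (v : HeightOneSpectrum (𝓞 F)) (hf : IsField (LocalRing E v)) :
    IsIrreducibleOrZero (localLemD1DataAtV₂ F E c N e JV hcδ hδ hd hV hVd hJV a 𝓢 hn μ hμn hμc hμF χ v).datum.quot ∧
      (localLemD1DataAtV₂ F E c N e JV hcδ hδ hd hV hVd hJV a 𝓢 hn μ hμn hμc hμF χ v).datum.quot.IsAdmissible := by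
  -- the two adjectives of `Θ_v` on the big group `U(J_V ⊗ (a))(F_v)` ([MVW, IV.4] PROVED; `E_v` a field)
  obtain ⟨hirr, hadm⟩ := isIrreducibleOrZero_and_isAdmissible_local_of_isField F E c N e JV hcδ hδ hd hV hVd hJV a 𝓢 χ.1
    (norm_chi_eq_one F E c (Algebra.IsQuadraticExtension.finrank_eq_two F E) (UnitaryGroup.algEquiv_ne_one_of_apply_eq_neg F E c hcδ hδ) χ)
    χ.2.1 v hf
  -- `Θ_v ∘ localLineInl v` on `U(J_V)(F_v)`: irreducible-or-zero (onto) and admissible (continuous + open)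
  have hirr₁ : IsIrreducibleOrZero (show Representation ℂ (UnitaryGroup.localPi E c N JV v) _ from
      (TwistedCoinv.rep (localCharOfCenter F E c (JW F E a) (JW_apply_ne_zero F E a) χ.1 v) (𝓢.omegaLoc v)
        (commute_omegaLoc_localCenter F E c N e JV (JW F E a) hcδ hδ hd hV (isSymm_TW F a) hJV (JW_eq F E a)
          (JW_apply_ne_zero F E a) 𝓢 v)).comp (UnitaryGroup.localLineInl E c N e JV (JW F E a) v)) :=
    (isIrreducibleOrZero_comp_iff_of_surjective _ (UnitaryGroup.localLineInl E c N e JV (JW F E a) v)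
      (UnitaryGroup.localLineInl_surjective E c N e JV (JW F E a) (JW_apply_ne_zero F E a) v)).2 hirr
  have hadm₁ : (show Representation ℂ (UnitaryGroup.localPi E c N JV v) _ from
      (TwistedCoinv.rep (localCharOfCenter F E c (JW F E a) (JW_apply_ne_zero F E a) χ.1 v) (𝓢.omegaLoc v)
        (commute_omegaLoc_localCenter F E c N e JV (JW F E a) hcδ hδ hd hV (isSymm_TW F a) hJV (JW_eq F E a)
          (JW_apply_ne_zero F E a) 𝓢 v)).comp (UnitaryGroup.localLineInl E c N e JV (JW F E a) v)).IsAdmissible :=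
    Representation.IsAdmissible.comp_of_continuous_of_isOpenMap hadm _ (LocalSplitting.continuous_localLineInl F E c N JV v e (JW F E a))
      (UnitaryGroup.isOpenMap_localLineInl E c N e JV (JW F E a) (JW_apply_ne_zero F E a) v)
  -- transport to the datum along `quotEquivLocalType₂` over `uEquiv`
  have h2 : (localLemD1DataAtV₂ F E c N e JV hcδ hδ hd hV hVd hJV a 𝓢 hn μ hμn hμc hμF χ v).datum.quot.IsAdmissible := by
    refine Representation.IsAdmissible.of_equivariant_mulEquiv _
      (LemD1OfPlace.uEquiv E v c N JV hcδ hδ (two_le_rank_of_two_le N e hn) (transpose_map_conj_JV F E c N JV hV hJV)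
        (det_JV_ne_zero F E N JV hVd hJV)).symm
      (quotEquivLocalType₂ F E c N e JV hcδ hδ hd hV hVd hJV a 𝓢 hn μ hμn hμc hμF χ v).toLinearEquiv.symm (fun g y => ?_) hadm₁
    have h := equiv_toLinearEquiv_apply_of_continuousMulEquiv
      (LemD1OfPlace.uEquiv E v c N JV hcδ hδ (two_le_rank_of_two_le N e hn) (transpose_map_conj_JV F E c N JV hV hJV)
        (det_JV_ne_zero F E N JV hVd hJV))
      (quotEquivLocalType₂ F E c N e JV hcδ hδ hd hV hVd hJV a 𝓢 hn μ hμn hμc hμF χ v)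
      ((LemD1OfPlace.uEquiv E v c N JV hcδ hδ (two_le_rank_of_two_le N e hn) (transpose_map_conj_JV F E c N JV hV hJV)
        (det_JV_ne_zero F E N JV hVd hJV)).symm g)
      ((quotEquivLocalType₂ F E c N e JV hcδ hδ hd hV hVd hJV a 𝓢 hn μ hμn hμc hμF χ v).toLinearEquiv.symm y)
    simp only [ContinuousMulEquiv.apply_symm_apply, LinearEquiv.apply_symm_apply] at h
    apply (quotEquivLocalType₂ F E c N e JV hcδ hδ hd hV hVd hJV a 𝓢 hn μ hμn hμc hμF χ v).toLinearEquiv.injective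
    rw [LinearEquiv.apply_symm_apply]
    exact h.symm
  refine ⟨?_, h2⟩
  -- «irreducible or zero»: zero ⇒ trivially; non-zero ⇒ Mathlib-irreducible upstairs, transported as in the split file
  rcases subsingleton_or_nontrivial (SchwartzBruhat (Fin n → v.adicCompletion F) ⧸
      augmentation (localLemD1DataAtV₂ F E c N e JV hcδ hδ hd hV hVd hJV a 𝓢 hn μ hμn hμc hμF χ v).omega
        (localLemD1DataAtV₂ F E c N e JV hcδ hδ hd hV hVd hJV a 𝓢 hn μ hμn hμc hμF χ v).S.scalar
        (localLemD1DataAtV₂ F E c N e JV hcδ hδ hd hV hVd hJV a 𝓢 hn μ hμn hμc hμF χ v).chi) with hq | hq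
  · exact isIrreducibleOrZero_of_subsingleton _
  · haveI := hq
    haveI hnt := (quotEquivLocalType₂ F E c N e JV hcδ hδ hd hV hVd hJV a 𝓢 hn μ hμn hμc hμF χ v).toLinearEquiv.toEquiv.nontrivial_congr.1 hq
    have hirrΘ := isIrreducible_of_nontrivial hirr₁
    exact isIrreducibleOrZero_of_isIrreducible ((Representation.isIrreducible_iff_of_equivariant _ _
      (LemD1OfPlace.uEquiv E v c N JV hcδ hδ (two_le_rank_of_two_le N e hn) (transpose_map_conj_JV F E c N JV hV hJV)
        (det_JV_ne_zero F E N JV hVd hJV)).toMulEquiv.toMonoidHom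
      (LemD1OfPlace.uEquiv E v c N JV hcδ hδ (two_le_rank_of_two_le N e hn) (transpose_map_conj_JV F E c N JV hV hJV)
        (det_JV_ne_zero F E N JV hVd hJV)).surjective
      (quotEquivLocalType₂ F E c N e JV hcδ hδ hd hV hVd hJV a 𝓢 hn μ hμn hμc hμF χ v).toLinearEquiv
      (equiv_toLinearEquiv_apply_of_monoidHom
        (LemD1OfPlace.uEquiv E v c N JV hcδ hδ (two_le_rank_of_two_le N e hn) (transpose_map_conj_JV F E c N JV hV hJV)
          (det_JV_ne_zero F E N JV hVd hJV)).toMulEquiv.toMonoidHom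
        (quotEquivLocalType₂ F E c N e JV hcδ hδ hd hV hVd hJV a 𝓢 hn μ hμn hμc hμF χ v))).2 hirrΘ)

end AtV


/-! ## §2 The reading on the rank-2 CM θ-package of the letter ★ `LemD1RankTwoCMLetters.LemD1_1AsPrintedNonsplitCM₂` -/

section CM

open NumberField.mixedEmbedding NumberField.InfinitePlace
open Literature.NumberTheory.GaloisRepresentations Literature.RepresentationTheory.HarrisKudlaSweet1996
open Literature.NumberTheory.Automorphic.IdeleClassGroup Literature.RepresentationTheory.Liu2021
open Literature.NumberTheory.Automorphic.Liu2021.Def411WeilCarriersDoubling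
open Literature.NumberTheory.GelbartRogawski1991.UnitaryDualPair.LocalSplitting

/-- **[Liu2021, Lem. D.1, FIRST SENTENCE] on the rank-2 CM θ-package `(λ′, a′, χ)` at a NON-SPLIT finite place `v` of `L⁺`, PROVED** — the
binders of the letter ★ `LemD1RankTwoCMLetters.LemD1_1AsPrintedNonsplitCM₂` (ED. 2 of `LemD1RankTwoCMLetters.lean`, p831213) at ONE place
`v` together with its non-split guard `hv`, and, as conclusion, LITERALLY the first conjunct `IsIrreducibleOrZero (…).datum.quot ∧
(…).datum.quot.IsAdmissible` of `LemD1_1AsPrinted` on the letter's own datum term `localLemD1DataAtV₂ (Fp L) L … a′ 𝓢_λ′,a′ … (localMu L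
(toHeckeCharacter L λ′)) … χ v`: `E_v = LocalRing L v` is a field because every place `w ∣ v` is fixed by `c` (contrapositive of ★
`SplitPlace.exists_placesOver_smul_ne_of_not_isField`), then §1.  Consumed by `LemD1RankTwoCMLetters.LemD1_1VanishingNonsplitCM₂.toNonsplit`
(row «L1ns-cut2» (T)).  [cite: Liu2021, App. D Lemma D.1, first sentence (p. 125, l. 5227); proof l. 5243 (p. 126)]
[cite: MoeglinVignerasWaldspurger1987, Chap. 3 IV.4 Thm principal 1a), 2a)] -/
theorem isIrreducibleOrZero_and_isAdmissible_localLemD1DataAtV₂_cm_of_forall_smul_eq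
    (L : Type) [Field L] [NumberField L] [IsCMField L]
      (dV : Fin 2 → L) (hdV : ∀ i, IsCMField.complexConj L (dV i) = dV i) (hdV0 : ∀ i, dV i ≠ 0)
      {n' : ℕ} (e₁ : Fin 2 × Fin 1 ≃ Fin n')
      (χ : Chi (↥(maximalRealSubfield L)) L (IsCMField.complexConj L)) (a' : (↥(maximalRealSubfield L))ˣ)
      (lam' : Literature.NumberTheory.Automorphic.IdeleClassGroup L →ₜ* Circle) (hlam' : IsConjugateSymplectic L lam')
      (v : HeightOneSpectrum (𝓞 ↥(maximalRealSubfield L)))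
    (hv : ∀ w : UnitaryGroup.PlacesOver L v, IsCMField.complexConj L • (w : HeightOneSpectrum (𝓞 L)) = w) :
    IsIrreducibleOrZero (localLemD1DataAtV₂ (Fp L) L (IsCMField.complexConj L) 2 e₁ (Matrix.diagonal dV) (complexConj_imagUnit L)
        (imagUnit_ne_zero L) (imagUnit_mul_self L) (realDiagonal_isSymm L dV hdV) (isUnit_det_realDiagonal L dV hdV hdV0)
        (realDiagonal_map L dV hdV).symm a' (congrW L e₁ dV hdV (lineW L (TW (Fp L) a')) (complexConj_lineW L (TW (Fp L) a')) (realDiagonal_lineW L (TW (Fp L) a')) (diagonal_lineW L (TW (Fp L) a') (JW_eq (Fp L) L a')) (undoubledSplittings L e₁ dV hdV hdV0 (lineW L (TW (Fp L) a')) (complexConj_lineW L (TW (Fp L) a')) (lineW_ne_zero L (TW (Fp L) a') (isUnit_det_TW (Fp L) a')) (toHeckeCharacter L lam') (borelPlaceMeasure L) (cmFinLocalFamily L e₁ dV hdV hdV0 (lineW L (TW (Fp L) a')) (complexConj_lineW L (TW (Fp L) a')) (lineW_ne_zero L (TW (Fp L) a') (isUnit_det_TW (Fp L) a')) (toHeckeCharacter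 L lam') ((isOscillatorChar_toHeckeCharacter_iff lam').mpr hlam') (borelPlaceMeasure L))) (isSymm_TW (Fp L) a') (JW_eq (Fp L) L a')) (by -- `2 ≤ n'` (§D.1 «rank n ≥ 2»); the assembler's proof argument here is `two_le_of_finTwo_equiv e₁`
          have h := Fintype.card_congr e₁
          simp only [Fintype.card_prod, Fintype.card_fin, mul_one] at h
          omega)
        (localMu L (toHeckeCharacter L lam')) (fun v x => norm_localMu L (toHeckeCharacter L lam') v (isUnitary_toHeckeCharacter L lam') x)
        (continuous_localMu L (toHeckeCharacter L lam'))
        (fun v t => localMu_toLocalRing_eq_one_iff L (toHeckeCharacter L lam') v ((isOscillatorChar_toHeckeCharacter_iff lam').mpr hlam') t)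
        χ v).datum.quot ∧
      (localLemD1DataAtV₂ (Fp L) L (IsCMField.complexConj L) 2 e₁ (Matrix.diagonal dV) (complexConj_imagUnit L)
        (imagUnit_ne_zero L) (imagUnit_mul_self L) (realDiagonal_isSymm L dV hdV) (isUnit_det_realDiagonal L dV hdV hdV0)
        (realDiagonal_map L dV hdV).symm a' (congrW L e₁ dV hdV (lineW L (TW (Fp L) a')) (complexConj_lineW L (TW (Fp L) a')) (realDiagonal_lineW L (TW (Fp L) a')) (diagonal_lineW L (TW (Fp L) a') (JW_eq (Fp L) L a')) (undoubledSplittings L e₁ dV hdV hdV0 (lineW L (TW (Fp L) a')) (complexConj_lineW L (TW (Fp L) a')) (lineW_ne_zero L (TW (Fp L) a') (isUnit_det_TW (Fp L) a')) (toHeckeCharacter L lam') (borelPlaceMeasure L) (cmFinLocalFamily L e₁ dV hdV hdV0 (lineW L (TW (Fp L) a')) (complexConj_lineW L (TW (Fp L) a')) (lineW_ne_zero L (TW (Fp L) a') (isUnit_det_TW (Fp L) a')) (toHeckeCharacter L lam') ((isOscillatorChar_toHeckeCharacter_iff lam').mpr hlam') (borelPlaceMeasure L))) (isSymm_TW (Fp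 L) a') (JW_eq (Fp L) L a')) (by -- `2 ≤ n'` (§D.1 «rank n ≥ 2»); the assembler's proof argument here is `two_le_of_finTwo_equiv e₁`
          have h := Fintype.card_congr e₁
          simp only [Fintype.card_prod, Fintype.card_fin, mul_one] at h
          omega)
        (localMu L (toHeckeCharacter L lam')) (fun v x => norm_localMu L (toHeckeCharacter L lam') v (isUnitary_toHeckeCharacter L lam') x)
        (continuous_localMu L (toHeckeCharacter L lam'))
        (fun v t => localMu_toLocalRing_eq_one_iff L (toHeckeCharacter L lam') v ((isOscillatorChar_toHeckeCharacter_iff lam').mpr hlam') t)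
        χ v).datum.quot.IsAdmissible := by
  have hf : IsField (LocalRing L v) := by
    by_contra h
    obtain ⟨w, hw⟩ := SplitPlace.exists_placesOver_smul_ne_of_not_isField L v (IsCMField.complexConj L)
      (UnitaryGroup.algEquiv_ne_one_of_apply_eq_neg (Fp L) L (IsCMField.complexConj L) (complexConj_imagUnit L) (imagUnit_ne_zero L)) h
    exact hw (hv w)
  exact isIrreducibleOrZero_and_isAdmissible_localLemD1DataAtV₂_of_isField (Fp L) L (IsCMField.complexConj L) 2 e₁ (Matrix.diagonal dV)
    (complexConj_imagUnit L) (imagUnit_ne_zero L) (imagUnit_mul_self L) (realDiagonal_isSymm L dV hdV) (isUnit_det_realDiagonal L dV hdV hdV0)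
    (realDiagonal_map L dV hdV).symm a' _ _ _ _ _ _ χ v hf

end CM

end Literature.NumberTheory.Automorphic.Liu2021.Def411WeilCarriers

end
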